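import Literature.NumberTheory.ComplexMultiplication.EllipticUnits.DeShalitDivisionPointsLatticeGeneral
import HarnessLib

/-!
# The lattice side conditions of the CM descent (N1) when `v̄² ∣ 𝔣` resp. `v̄³ ∣ 𝔣` — WITHOUT `2^m ∉ 𝔣`
# (de Shalit II.4.4 (iv); the tame set `S = ∅`, i.e. `𝔣 = v̄^M`, included — proofs only)

Topic `NumberTheory/ComplexMultiplication/EllipticUnits` (theorems only; no definition, no named fact, no instance).  Cell `bsd-print-cf2`,
width seat `bsd-line-cf2-p1-w5` g18, piece (N1)-S∅.

`DeShalitDivisionPointsLatticeGeneral` proves the three non-memberships that feed the (N1) kernel-membership package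
(`base_add_nsmul_divisionPt_add_notMem`, `mul_base_add_nsmul_divisionPt_add_notMem`,
`mul_nsmul_divisionPt_add_add_two_mul_notMem`) under the hypothesis `∀ m, 2^m ∉ 𝔣`, by clearing denominators with a power of `2`.
On the lane of cell `bsd-print-cf2` the modulus is `𝔣 = 𝔪_M = ∏_{w ∈ S ∪ {v̄}} w^M`, and `2^M ∈ 𝔪_M` EXACTLY when the tame set `S` is empty
(`𝔣 = v̄^M`): there that hypothesis fails.  This file proves the same three statements from the divisibility of `𝔣` by a power of the
conjugate prime instead — `𝔣 ≤ (π₁²)` for the first two, `𝔣 ≤ (π₁³)` for the exclusion — with `π₁` prime and `π₀ + π₁ = 1` (so `π₁ ∤ π₀`);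
both regimes (`S ≠ ∅` and `S = ∅`, every level `M ≥ 3`) are covered at once, since `v̄^M ∣ 𝔪_M`.  Method: multiply the membership by
`π₁·π₀^{N+1}` (resp. `π₁·π₀^N`), land in `Ω·ι(𝒪_K)`, read off an element of `𝔣` (`mul_mem_lattice_iff_of_model`), and compare `π₁`-adic
divisibilities: every term but `π₁π₀^{N+1}` (resp. `π₀^{N+2}π₁²`) is divisible by `π₁²` (resp. `π₁³`).

* §1 algebra of the modulus: `not_dvd_of_add_eq_one` (`π₁ ∤ π₀`), `pow_notMem_of_le_span_pow` (`π₀^n ∉ 𝔣`), `two_notMem_of_le_span_sq`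
  (`2 ∉ 𝔣`), `ne_top_of_le_span_pow` (`𝔣 ≠ ⊤`), `le_span_sq_of_le_span_cube`;
* §2 the key identities `gen_mul_pow_mul_base_add_nsmul_divisionPt_add_eq`, `gen_mul_pow_mul_nsmul_divisionPt_add_add_two_mul_eq` and the
  memberships they produce;
* §3 ★ `base_add_nsmul_divisionPt_add_notMem_of_le_span_sq` (`Ω + (k·u_{N+1} + ub) ∉ L`),
  ★ `mul_base_add_nsmul_divisionPt_add_notMem_of_le_span_sq` (`π₀·(Ω + (k·u_{N+1} + ub)) ∉ L`),
  ★ `mul_nsmul_divisionPt_add_add_two_mul_notMem_of_le_span_cube` (the EXCLUSION `π₀·(k·u_{N+1} + ub) + 2π₀Ω ∉ L`).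
  (At `𝔣 = (π₁²)` the exclusion is genuinely false for every admissible `ub` — witness `N = 1`, `k = 2` when `𝒪_K/(π₁) ≅ 𝔽₂` — so the
  cube is needed: on the lane, levels `M ≥ 3`.)

No summit statement is proved; BSD is not proved by any of this.

## References
* [deShalit1987] E. de Shalit, *Iwasawa theory of elliptic curves with complex multiplication* (1987), II §4.2 (6), II §4.4 Definition, (iv).
* [SilvermanAEC2009] J. H. Silverman, *The Arithmetic of Elliptic Curves*, 2nd ed. (2009), Prop. VI.3.6 (b).
-/

noncomputable section

open scoped Classical
open NumberField PeriodPair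

namespace Literature.NumberTheory.ComplexMultiplication.EllipticUnits

variable {K : Type} [Field K] (ι : K →+* ℂ) {𝔣 : Ideal (𝓞 K)} {L : PeriodPair} {Ω : ℂ}
  (hL : ∀ z : ℂ, z ∈ L.lattice ↔ ∃ a ∈ 𝔣, z = Ω * ι (a : K)) {β π₀ π₁ : 𝓞 K}

/-! ## §1 Algebra of a modulus divisible by a power of the conjugate prime -/

section Algebra

/-- `π₀ + π₁ = 1` and `π₁` prime ⟹ `π₁ ∤ π₀` (else `π₁ ∣ 1`). [cite: deShalit1987, II §4.1] -/
theorem not_dvd_of_add_eq_one (hprime₁ : Prime π₁) (htr : π₀ + π₁ = 1) : ¬ π₁ ∣ π₀ := by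
  intro h
  have h1 : π₁ ∣ 1 := by rw [← htr]; exact dvd_add h (dvd_refl π₁)
  exact hprime₁.not_unit (isUnit_of_dvd_one h1)

/-- `x ∈ 𝔣 ≤ (π₁ⁿ) ⟹ π₁ⁿ ∣ x`. [folklore] -/
private theorem pow_dvd_of_mem_of_le_span_pow {n : ℕ} (h𝔣 : 𝔣 ≤ Ideal.span {π₁ ^ n}) {x : 𝓞 K} (hx : x ∈ 𝔣) : π₁ ^ n ∣ x :=
  Ideal.mem_span_singleton.mp (h𝔣 hx)

/-- `𝔣 ≤ (π₁³) ⟹ 𝔣 ≤ (π₁²)` (the lane modulus `𝔪_M`, `M ≥ 3`, read at the square). [cite: deShalit1987, II §4.4 (iv)] -/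
theorem le_span_sq_of_le_span_cube (h𝔣 : 𝔣 ≤ Ideal.span {π₁ ^ 3}) : 𝔣 ≤ Ideal.span {π₁ ^ 2} :=
  h𝔣.trans (Ideal.span_singleton_le_span_singleton.mpr (pow_dvd_pow π₁ (by norm_num)))

/-- **`π₀ᵐ ∉ 𝔣`** when `𝔣 ≤ (π₁ⁿ)`, `n ≥ 1`, `π₁` prime, `π₀ + π₁ = 1`. [cite: deShalit1987, II §4.4 (iv)] -/
theorem pow_notMem_of_le_span_pow (hprime₁ : Prime π₁) (htr : π₀ + π₁ = 1) {n : ℕ} (hn : n ≠ 0)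
    (h𝔣 : 𝔣 ≤ Ideal.span {π₁ ^ n}) (m : ℕ) : (π₀ ^ m : 𝓞 K) ∉ 𝔣 := by
  intro h
  have h1 : π₁ ∣ π₀ ^ m := (dvd_pow_self π₁ hn).trans (pow_dvd_of_mem_of_le_span_pow h𝔣 h)
  exact not_dvd_of_add_eq_one hprime₁ htr (hprime₁.dvd_of_dvd_pow h1)

/-- **`2 ∉ 𝔣`** when `𝔣 ≤ (π₁²)`, `2 = π₀π₁`, `π₁` prime, `π₀ + π₁ = 1` (`π₁² ∣ π₀π₁ ⟹ π₁ ∣ π₀`). [cite: deShalit1987, II §4.4 (iv)] -/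
theorem two_notMem_of_le_span_sq (hprime₁ : Prime π₁) (htr : π₀ + π₁ = 1) (h2 : (2 : 𝓞 K) = π₀ * π₁)
    (h𝔣 : 𝔣 ≤ Ideal.span {π₁ ^ 2}) : (2 : 𝓞 K) ∉ 𝔣 := by
  intro h
  have h1 : π₁ ^ 2 ∣ π₀ * π₁ := h2 ▸ pow_dvd_of_mem_of_le_span_pow h𝔣 h
  rw [pow_two, mul_comm π₀ π₁, mul_dvd_mul_iff_left hprime₁.ne_zero] at h1
  exact not_dvd_of_add_eq_one hprime₁ htr h1

/-- `((2 : 𝓞 K) ^ 1 : 𝓞 K) ∉ 𝔣` — the shape `h𝔪2 1` consumed by `DivisionPointReadingsAtLevel`. [cite: deShalit1987, II §4.4 (iv)] -/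
theorem two_pow_one_notMem_of_le_span_sq (hprime₁ : Prime π₁) (htr : π₀ + π₁ = 1) (h2 : (2 : 𝓞 K) = π₀ * π₁)
    (h𝔣 : 𝔣 ≤ Ideal.span {π₁ ^ 2}) : ((2 : 𝓞 K) ^ 1 : 𝓞 K) ∉ 𝔣 := by
  rw [pow_one]; exact two_notMem_of_le_span_sq hprime₁ htr h2 h𝔣

/-- **`𝔣 ≠ ⊤`** when `𝔣 ≤ (π₁ⁿ)`, `n ≥ 1`, `π₁` prime (the modulus of II §4.4 is proper). [cite: deShalit1987, II §4.4 Definition] -/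
theorem ne_top_of_le_span_pow (hprime₁ : Prime π₁) {n : ℕ} (hn : n ≠ 0) (h𝔣 : 𝔣 ≤ Ideal.span {π₁ ^ n}) : 𝔣 ≠ ⊤ := by
  intro h
  have h1 : π₁ ∣ 1 := (dvd_pow_self π₁ hn).trans (pow_dvd_of_mem_of_le_span_pow h𝔣 (h ▸ Submodule.mem_top))
  exact hprime₁.not_unit (isUnit_of_dvd_one h1)

/-- `π₁ⁿ ∣ (βπ₀)^m − 1` when `βπ₀ ≡ 1 (mod 𝔣)` and `𝔣 ≤ (π₁ⁿ)`. [cite: deShalit1987, II §4.4] -/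
theorem pow_dvd_pow_mul_sub_one (hβ : β * π₀ - 1 ∈ 𝔣) {n : ℕ} (h𝔣 : 𝔣 ≤ Ideal.span {π₁ ^ n}) (m : ℕ) :
    π₁ ^ n ∣ (β * π₀) ^ m - 1 :=
  pow_dvd_of_mem_of_le_span_pow h𝔣 (pow_mul_sub_one_mem hβ m)

/-- The `π₁`-adic endgame of §3 (square case): if `π₁π₀^{N+1} + k·π₁·((βπ₀)^{N+1} − 1) + π₀^{N+1}·m ∈ 𝔣` with `m ∈ 𝔣 ≤ (π₁²)`, then
`π₁² ∣ π₁π₀^{N+1}`, i.e. `π₁ ∣ π₀` — absurd. [cite: deShalit1987, II §4.4 (iv)] -/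
theorem false_of_key_mem_of_le_span_sq (hprime₁ : Prime π₁) (htr : π₀ + π₁ = 1) (hβ : β * π₀ - 1 ∈ 𝔣)
    (h𝔣 : 𝔣 ≤ Ideal.span {π₁ ^ 2}) {m : 𝓞 K} (hm : m ∈ 𝔣) {N : ℕ} {k : 𝓞 K}
    (hc : π₁ * π₀ ^ (N + 1) + k * π₁ * ((β * π₀) ^ (N + 1) - 1) + π₀ ^ (N + 1) * m ∈ 𝔣) : False := by
  have hd1 : π₁ ^ 2 ∣ π₁ * π₀ ^ (N + 1) + k * π₁ * ((β * π₀) ^ (N + 1) - 1) + π₀ ^ (N + 1) * m :=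
    pow_dvd_of_mem_of_le_span_pow h𝔣 hc
  have hd2 : π₁ ^ 2 ∣ k * π₁ * ((β * π₀) ^ (N + 1) - 1) := dvd_mul_of_dvd_right (pow_dvd_pow_mul_sub_one hβ h𝔣 _) _
  have hd3 : π₁ ^ 2 ∣ π₀ ^ (N + 1) * m := dvd_mul_of_dvd_right (pow_dvd_of_mem_of_le_span_pow h𝔣 hm) _
  have hd : π₁ ^ 2 ∣ π₁ * π₀ ^ (N + 1) := by
    have := dvd_sub (dvd_sub hd1 hd2) hd3
    convert this using 1
    ring
  rw [pow_two, mul_dvd_mul_iff_left hprime₁.ne_zero] at hd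
  exact not_dvd_of_add_eq_one hprime₁ htr (hprime₁.dvd_of_dvd_pow hd)

/-- The `π₁`-adic endgame of §3 (cube case): if `k·π₁·((βπ₀)^{N+1} − 1) + π₀^{N+1}·m + 2·π₁·π₀^{N+1} ∈ 𝔣` with `m ∈ 𝔣 ≤ (π₁³)` and
`2 = π₀π₁`, then `π₁³ ∣ π₀^{N+2}·π₁²`, i.e. `π₁ ∣ π₀^{N+2}` — absurd. [cite: deShalit1987, II §4.4 (iv)] -/
theorem false_of_key_mem_of_le_span_cube (hprime₁ : Prime π₁) (htr : π₀ + π₁ = 1) (h2 : (2 : 𝓞 K) = π₀ * π₁)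
    (hβ : β * π₀ - 1 ∈ 𝔣) (h𝔣 : 𝔣 ≤ Ideal.span {π₁ ^ 3}) {m : 𝓞 K} (hm : m ∈ 𝔣) {N : ℕ} {k : 𝓞 K}
    (hc : k * π₁ * ((β * π₀) ^ (N + 1) - 1) + π₀ ^ (N + 1) * m + 2 * π₁ * π₀ ^ (N + 1) ∈ 𝔣) : False := by
  have hd1 : π₁ ^ 3 ∣ k * π₁ * ((β * π₀) ^ (N + 1) - 1) + π₀ ^ (N + 1) * m + 2 * π₁ * π₀ ^ (N + 1) :=
    pow_dvd_of_mem_of_le_span_pow h𝔣 hc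
  have hd2 : π₁ ^ 3 ∣ k * π₁ * ((β * π₀) ^ (N + 1) - 1) := dvd_mul_of_dvd_right (pow_dvd_pow_mul_sub_one hβ h𝔣 _) _
  have hd3 : π₁ ^ 3 ∣ π₀ ^ (N + 1) * m := dvd_mul_of_dvd_right (pow_dvd_of_mem_of_le_span_pow h𝔣 hm) _
  have hd : π₁ ^ 3 ∣ π₀ ^ (N + 2) * π₁ ^ 2 := by
    have := dvd_sub (dvd_sub hd1 hd2) hd3
    rw [show k * π₁ * ((β * π₀) ^ (N + 1) - 1) + π₀ ^ (N + 1) * m + 2 * π₁ * π₀ ^ (N + 1) - k * π₁ * ((β * π₀) ^ (N + 1) - 1) -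
      π₀ ^ (N + 1) * m = 2 * π₁ * π₀ ^ (N + 1) by ring, h2] at this
    convert this using 1
    ring
  have hnd : ¬ π₁ ∣ π₀ ^ (N + 2) := fun h => not_dvd_of_add_eq_one hprime₁ htr (hprime₁.dvd_of_dvd_pow h)
  have hd' : π₁ ^ 3 ∣ π₁ ^ 2 := hprime₁.pow_dvd_of_dvd_mul_left 3 hnd hd
  have : π₁ ∣ 1 := by
    have h1 : π₁ ^ 2 * π₁ ∣ π₁ ^ 2 * 1 := by rwa [mul_one, ← pow_succ]
    exact (mul_dvd_mul_iff_left (pow_ne_zero 2 hprime₁.ne_zero)).mp h1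
  exact hprime₁.not_unit (isUnit_of_dvd_one this)

end Algebra

/-! ## §2 The key identities: multiplying by `π₁·π₀^{N+1}` lands in `Ω·ι(𝒪_K)` -/

section Key

variable {ub : ℂ} {N k : ℕ}

/-- **`ι(π₁π₀^{N+1})·(Ω + (k·u_{N+1} + ub)) = Ω·ι(π₁π₀^{N+1} + kπ₁((βπ₀)^{N+1} − 1) + π₀^{N+1}m)`** when `ι(π₁)·ub = Ω·ι(m)`
(`ι(π₀^{N+1})·u_{N+1} = Ω·ι((βπ₀)^{N+1} − 1)`). [cite: deShalit1987, II §4.4 Definition, (iv)] -/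
theorem gen_mul_pow_mul_base_add_nsmul_divisionPt_add_eq (hπ₀ : π₀ ≠ 0) {m : 𝓞 K} (hm : ι (π₁ : K) * ub = Ω * ι (m : K))
    (N k : ℕ) :
    ι ((π₁ * π₀ ^ (N + 1) : 𝓞 K) : K) * (Ω + ((k : ℂ) * (ι ((β ^ (N + 1) : 𝓞 K) : K) * Ω - Ω / ι ((π₀ ^ (N + 1) : 𝓞 K) : K)) + ub)) =
      Ω * ι (((π₁ * π₀ ^ (N + 1) + (k : 𝓞 K) * π₁ * ((β * π₀) ^ (N + 1) - 1) + π₀ ^ (N + 1) * m : 𝓞 K)) : K) := by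
  have e := pow_mul_divisionPt_eq ι (Ω := Ω) hπ₀ β (N + 1)
  push_cast at e ⊢
  simp only [map_mul, map_pow, map_add, map_sub, map_one, map_natCast] at e ⊢
  linear_combination (k : ℂ) * ι (π₁ : K) * e + ι (π₀ : K) ^ (N + 1) * hm

/-- **`ι(π₁π₀^N)·(ι(π₀)·(k·u_{N+1} + ub) + 2ι(π₀)Ω) = Ω·ι(kπ₁((βπ₀)^{N+1} − 1) + π₀^{N+1}m + 2π₁π₀^{N+1})`** when `ι(π₁)·ub = Ω·ι(m)`.
[cite: deShalit1987, II §4.4 Definition, (iv)] -/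
theorem gen_mul_pow_mul_nsmul_divisionPt_add_add_two_mul_eq (hπ₀ : π₀ ≠ 0) {m : 𝓞 K} (hm : ι (π₁ : K) * ub = Ω * ι (m : K))
    (N k : ℕ) :
    ι ((π₁ * π₀ ^ N : 𝓞 K) : K) * (ι (π₀ : K) * ((k : ℂ) * (ι ((β ^ (N + 1) : 𝓞 K) : K) * Ω - Ω / ι ((π₀ ^ (N + 1) : 𝓞 K) : K)) + ub) +
        2 * (ι (π₀ : K) * Ω)) =
      Ω * ι (((((k : 𝓞 K) * π₁ * ((β * π₀) ^ (N + 1) - 1) + π₀ ^ (N + 1) * m + 2 * π₁ * π₀ ^ (N + 1) : 𝓞 K)) : K)) := by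
  have e := pow_mul_divisionPt_eq ι (Ω := Ω) hπ₀ β (N + 1)
  push_cast at e ⊢
  simp only [map_mul, map_pow, map_add, map_sub, map_one, map_natCast, map_ofNat] at e ⊢
  linear_combination (k : ℂ) * ι (π₁ : K) * e + ι (π₀ : K) ^ (N + 1) * hm

include hL in
/-- From `Ω + (k·u_{N+1} + ub) ∈ L`: the key element `π₁π₀^{N+1} + kπ₁((βπ₀)^{N+1} − 1) + π₀^{N+1}m` lies in `𝔣` (`ι(π₁)ub = Ω·ι(m)`).
[cite: deShalit1987, II §4.4 (iv)] -/
theorem key_mem_of_base_add_nsmul_divisionPt_add_mem (hΩ : Ω ≠ 0) (hπ₀ : π₀ ≠ 0) {m : 𝓞 K} (hm : ι (π₁ : K) * ub = Ω * ι (m : K))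
    (h : Ω + ((k : ℂ) * (ι ((β ^ (N + 1) : 𝓞 K) : K) * Ω - Ω / ι ((π₀ ^ (N + 1) : 𝓞 K) : K)) + ub) ∈ L.lattice) :
    π₁ * π₀ ^ (N + 1) + (k : 𝓞 K) * π₁ * ((β * π₀) ^ (N + 1) - 1) + π₀ ^ (N + 1) * m ∈ 𝔣 := by
  have h1 := isCMLattice_of_model ι hL (π₁ * π₀ ^ (N + 1)) _ h
  rwa [gen_mul_pow_mul_base_add_nsmul_divisionPt_add_eq ι hπ₀ hm, mul_mem_lattice_iff_of_model ι hL hΩ] at h1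

include hL in
/-- From `ι(π₀)·(Ω + (k·u_{N+1} + ub)) ∈ L`: the same key element lies in `𝔣` (multiply by `π₁π₀^N`). [cite: deShalit1987, II §4.4 (iv)] -/
theorem key_mem_of_mul_base_add_nsmul_divisionPt_add_mem (hΩ : Ω ≠ 0) (hπ₀ : π₀ ≠ 0) {m : 𝓞 K} (hm : ι (π₁ : K) * ub = Ω * ι (m : K))
    (h : ι (π₀ : K) * (Ω + ((k : ℂ) * (ι ((β ^ (N + 1) : 𝓞 K) : K) * Ω - Ω / ι ((π₀ ^ (N + 1) : 𝓞 K) : K)) + ub)) ∈ L.lattice) :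
    π₁ * π₀ ^ (N + 1) + (k : 𝓞 K) * π₁ * ((β * π₀) ^ (N + 1) - 1) + π₀ ^ (N + 1) * m ∈ 𝔣 := by
  have h1 := isCMLattice_of_model ι hL (π₁ * π₀ ^ N) _ h
  have e : ι ((π₁ * π₀ ^ N : 𝓞 K) : K) *
      (ι (π₀ : K) * (Ω + ((k : ℂ) * (ι ((β ^ (N + 1) : 𝓞 K) : K) * Ω - Ω / ι ((π₀ ^ (N + 1) : 𝓞 K) : K)) + ub))) =
      ι ((π₁ * π₀ ^ (N + 1) : 𝓞 K) : K) * (Ω + ((k : ℂ) * (ι ((β ^ (N + 1) : 𝓞 K) : K) * Ω - Ω / ι ((π₀ ^ (N + 1) : 𝓞 K) : K)) + ub)) := by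
    push_cast
    simp only [map_mul, map_pow]
    ring
  rwa [e, gen_mul_pow_mul_base_add_nsmul_divisionPt_add_eq ι hπ₀ hm, mul_mem_lattice_iff_of_model ι hL hΩ] at h1

include hL in
/-- From `ι(π₀)·(k·u_{N+1} + ub) + 2ι(π₀)Ω ∈ L`: `kπ₁((βπ₀)^{N+1} − 1) + π₀^{N+1}m + 2π₁π₀^{N+1} ∈ 𝔣`. [cite: deShalit1987, II §4.4 (iv)] -/
theorem key_mem_of_mul_nsmul_divisionPt_add_add_two_mul_mem (hΩ : Ω ≠ 0) (hπ₀ : π₀ ≠ 0) {m : 𝓞 K}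
    (hm : ι (π₁ : K) * ub = Ω * ι (m : K))
    (h : ι (π₀ : K) * ((k : ℂ) * (ι ((β ^ (N + 1) : 𝓞 K) : K) * Ω - Ω / ι ((π₀ ^ (N + 1) : 𝓞 K) : K)) + ub) + 2 * (ι (π₀ : K) * Ω) ∈
      L.lattice) :
    (k : 𝓞 K) * π₁ * ((β * π₀) ^ (N + 1) - 1) + π₀ ^ (N + 1) * m + 2 * π₁ * π₀ ^ (N + 1) ∈ 𝔣 := by
  have h1 := isCMLattice_of_model ι hL (π₁ * π₀ ^ N) _ h
  rwa [gen_mul_pow_mul_nsmul_divisionPt_add_add_two_mul_eq ι hπ₀ hm, mul_mem_lattice_iff_of_model ι hL hΩ] at h1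

end Key

/-! ## §3 The three non-memberships under `𝔣 ≤ (π₁²)` / `𝔣 ≤ (π₁³)` -/

section NotMem

variable {ub : ℂ} {N k : ℕ}

include hL in
/-- ★ **`Ω + (k·u_{N+1} + ub) ∉ L`** for `𝔣 ≤ (π₁²)`, `π₁` prime, `π₀ + π₁ = 1`, `βπ₀ ≡ 1 (mod 𝔣)`, `ι(π₁)ub ∈ L` — the twin of
`base_add_nsmul_divisionPt_add_notMem` without `2^m ∉ 𝔣` (covers `𝔣 = v̄^M`, `M ≥ 2`). [cite: deShalit1987, II §4.4 (iv)] -/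
theorem base_add_nsmul_divisionPt_add_notMem_of_le_span_sq (hΩ : Ω ≠ 0) (hprime₁ : Prime π₁) (htr : π₀ + π₁ = 1)
    (hβ : β * π₀ - 1 ∈ 𝔣) (hπ₀ : π₀ ≠ 0) (hub1 : ι (π₁ : K) * ub ∈ L.lattice) (h𝔣 : 𝔣 ≤ Ideal.span {π₁ ^ 2}) :
    Ω + ((k : ℂ) * (ι ((β ^ (N + 1) : 𝓞 K) : K) * Ω - Ω / ι ((π₀ ^ (N + 1) : 𝓞 K) : K)) + ub) ∉ L.lattice := by
  intro h
  obtain ⟨m, hm𝔣, hm⟩ := (hL _).mp hub1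
  exact false_of_key_mem_of_le_span_sq hprime₁ htr hβ h𝔣 hm𝔣
    (key_mem_of_base_add_nsmul_divisionPt_add_mem ι hL hΩ hπ₀ hm h)

include hL in
/-- ★ **`ι(π₀)·(Ω + (k·u_{N+1} + ub)) ∉ L`** for `𝔣 ≤ (π₁²)` — the twin of `mul_base_add_nsmul_divisionPt_add_notMem` without `2^m ∉ 𝔣`.
[cite: deShalit1987, II §4.4 (iv)] -/
theorem mul_base_add_nsmul_divisionPt_add_notMem_of_le_span_sq (hΩ : Ω ≠ 0) (hprime₁ : Prime π₁) (htr : π₀ + π₁ = 1)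
    (hβ : β * π₀ - 1 ∈ 𝔣) (hπ₀ : π₀ ≠ 0) (hub1 : ι (π₁ : K) * ub ∈ L.lattice) (h𝔣 : 𝔣 ≤ Ideal.span {π₁ ^ 2}) :
    ι (π₀ : K) * (Ω + ((k : ℂ) * (ι ((β ^ (N + 1) : 𝓞 K) : K) * Ω - Ω / ι ((π₀ ^ (N + 1) : 𝓞 K) : K)) + ub)) ∉ L.lattice := by
  intro h
  obtain ⟨m, hm𝔣, hm⟩ := (hL _).mp hub1
  exact false_of_key_mem_of_le_span_sq hprime₁ htr hβ h𝔣 hm𝔣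
    (key_mem_of_mul_base_add_nsmul_divisionPt_add_mem ι hL hΩ hπ₀ hm h)

include hL in
/-- ★ **The exclusion `ι(π₀)·(k·u_{N+1} + ub) + 2ι(π₀)Ω ∉ L`** for `𝔣 ≤ (π₁³)`, `2 = π₀π₁` — the twin of
`mul_nsmul_divisionPt_add_add_two_mul_notMem` without `2^m ∉ 𝔣` (`hexcl` of `DivisionPointsLaneDescent`; covers `𝔣 = v̄^M`, `M ≥ 3`;
false at `M = 2`). [cite: deShalit1987, II §4.4 (iv)] -/
theorem mul_nsmul_divisionPt_add_add_two_mul_notMem_of_le_span_cube (hΩ : Ω ≠ 0) (hprime₁ : Prime π₁) (htr : π₀ + π₁ = 1)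
    (h2 : (2 : 𝓞 K) = π₀ * π₁) (hβ : β * π₀ - 1 ∈ 𝔣) (hπ₀ : π₀ ≠ 0) (hub1 : ι (π₁ : K) * ub ∈ L.lattice)
    (h𝔣 : 𝔣 ≤ Ideal.span {π₁ ^ 3}) :
    ι (π₀ : K) * ((k : ℂ) * (ι ((β ^ (N + 1) : 𝓞 K) : K) * Ω - Ω / ι ((π₀ ^ (N + 1) : 𝓞 K) : K)) + ub) + 2 * (ι (π₀ : K) * Ω) ∉
      L.lattice := by
  intro h
  obtain ⟨m, hm𝔣, hm⟩ := (hL _).mp hub1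
  exact false_of_key_mem_of_le_span_cube hprime₁ htr h2 hβ h𝔣 hm𝔣
    (key_mem_of_mul_nsmul_divisionPt_add_add_two_mul_mem ι hL hΩ hπ₀ hm h)

end NotMem

end Literature.NumberTheory.ComplexMultiplication.EllipticUnits

end
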